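import Summits.ResolutionOfSingularities.ResolutionOfSingularities.Theorems.HoleCutPoverty
import Summits.ResolutionOfSingularities.ResolutionOfSingularities.Theorems.HoleCutClasses
import Summits.ResolutionOfSingularities.ResolutionOfSingularities.Theorems.MaxContactCutTightCut
import HarnessLib

/-!
# MaxContactCutHoleCut — decomp-res node «HoleCut» (lens-3 g18, critic row 143), tree file 4/4 of the node

Content VERBATIM from the decomp-res lens-3 g18 file `HOME/decomp-res-lens-3/g18/HoleCut.lean` (sha256 55250664…,
3677 l; = `parts/HoleCut-NODE-55250664.lean`;
HOME = run/shared/lean/pub/decomp-res), NEW sections only: its carried l. 89–3133 are lens-3 g17 TightCut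
@7fe2fb69 VERBATIM and ALREADY in the tree as
`Theorems/TightCut*` / `MaxContactCutTightCut` (and the g13–g16 chain below them) — not landed again; the §M
root `closes` (≡ `MaxContactCutExponentLadder.closes`)
is not restated.  Critic: CRITIC-LEDGER row 143 (CLEARED 2026-08-30T20:55:21Z); landing plan NODE-g18 §6.  Landed
by decomp-res writer g7 in the lens's namespace
`…Theorems.HoleCut` with `open …Theorems.TightCut` (the carried decls resolve against the landed TightCut
files).  Aside budget: the g17 residual 28532
`TightNoJointTailsFromFourDeep` is KEPT as the one booked item and re-informalled with its EXACT two-piece form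
`four_iff_hole` (pieces A `NoSubcriticalJointTailsDeep`,
B `NoHoleFillingTailsDeep`, both in the cone-free `HoleCutClasses`), per the critic's budget option.

Wiring (Theses cone, BY NAME on the MaxContactCut aside `DefectWalksDeep` 31770): §K4 minus the two piece defs —
the DECIDED class `NoSupercriticalHoleFreeJointTailsDeep` with
`noSupercriticalHoleFreeJointTails_holds` (supercritical hole-free joint tails EMPTY at every shade at once),
`sub_of_four` / `hole_of_four` / `four_of_hole`, EXACT
`four_iff_hole : TightCut.NoJointTailsFromFourDeep ↔ NoSubcriticalJointTailsDeep ∧ NoHoleFillingTailsDeep`,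
`three_iff_hole`, `joint_iff_hole`, `defectWalksDeep_of_hole`,
hypothesis-free `defectWalksDeep_iff_hole`, `sub_of_defectWalksDeep` / `hole_of_defectWalksDeep`,
`supercriticalHoleFree_of_joint`.  Imports `HoleCutPoverty`, `HoleCutClasses`,
`MaxContactCutTightCut`.  Supports 31770.

[WRITER NOTE (decomp-res writer g7): section split only; every declaration as in the lens except: the lens's private
`eq_of_le_of_degree_le` (a `Fin 3` copy of the
tree's `ExitLaw.eq_of_le_of_degree_le`, opened here) is not restated; `chartExponent_of_ne` ↦ the landed
`ProximityCut.chartExponent_apply_ne` and `exists_third a b h` ↦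
`ConeCut.exists_third h` exactly as in the landed TightCut files; global `set_option` dropped.]

(Sources: CossartPiltant2008 Prop. 4.2; CossartPiltant2009; CossartJannsenSaito2020; Hauser2010; Moh1987;
BenitoVillamayor2012; HauserPerlega2024.)
-/

noncomputable section

open MvPolynomial Finset
open Literature.AlgebraicGeometry.Resolution
open Literature.AlgebraicGeometry.Resolution.Hauser2010
open Literature.AlgebraicGeometry.Resolution.PointBlowup
open Summit.ResolutionOfSingularities.ResolutionOfSingularities.Theses
open Summit.ResolutionOfSingularities.ResolutionOfSingularities.Theorems.TightDefectClasses
open Summit.ResolutionOfSingularities.ResolutionOfSingularities.Theorems.TightDefectStrongWalks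
open Summit.ResolutionOfSingularities.ResolutionOfSingularities.Theorems.ItineraryCutClasses
open Summit.ResolutionOfSingularities.ResolutionOfSingularities.Theorems.BoundaryLedger
open Summit.ResolutionOfSingularities.ResolutionOfSingularities.Theorems.ProximityCut
open Summit.ResolutionOfSingularities.ResolutionOfSingularities.Theorems.ConeCutAxisLaw
open Literature.AlgebraicGeometry.Resolution.WeightedBlowup
open Literature.Barriers.ResolutionOfSingularities
open Summit.ResolutionOfSingularities.ResolutionOfSingularities.Theorems.FloorCut
open Summit.ResolutionOfSingularities.ResolutionOfSingularities.Theorems.ConeCut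
open Summit.ResolutionOfSingularities.ResolutionOfSingularities.Theorems.ExitLaw (fin3_cases eq_of_le_of_degree_le)
open Summit.ResolutionOfSingularities.ResolutionOfSingularities.Theorems.ShadeCut
open Summit.ResolutionOfSingularities.ResolutionOfSingularities.Theorems.TightCut

namespace Summit.ResolutionOfSingularities.ResolutionOfSingularities.Theorems.HoleCut

section BookingHole

/-- PIECE · THE DECIDED WINDOW OF THIS NODE — SUPERCRITICAL HOLE-FREE JOINT TAILS, ALL SHADES AT ONCE (binders
VERBATIM, plus `shade_N = s`, `3s ≤ p^e + 2`, and «eventually no move is hole-filling») · WEAKER than the joint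
residual by letter · **DECIDED — PROVED EMPTY** (`noSupercriticalHoleFreeJointTails_holds`: the parametric poverty
ledger §P₊). -/
def NoSupercriticalHoleFreeJointTailsDeep : Prop :=
  ∀ p : ℕ, p.Prime → ∀ e : ℕ, 2 ≤ e → ∀ (K : Type) [Field K] [CharP K p] [PerfectField K] [DecidableEq K]
    (s₀ : State (Fin 3) K), IsRoot (p ^ e) s₀ → ∀ W : ForcedWalk (p ^ e) s₀, (∀ i, 1 ≤ (W.st i).shade) →
    ∀ N : ℕ, (∀ t, N ≤ t → (W.st (t + 1)).shade = (W.st t).shade) →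
    (∀ t, N ≤ t → ordZero (W.st t).F ≠ ((p ^ e : ℕ) : ℕ∞)) → (∀ M : ℕ, ∃ t, M ≤ t ∧ StaysOnNewest W t) →
    (∀ M : ℕ, ∃ t, M ≤ t ∧ W.b t ≠ 0) →
    ∀ s : ℕ, (W.st N).shade = (s : ℕ∞) → 3 * s ≤ p ^ e + 2 →
    (∃ M : ℕ, ∀ t, M ≤ t → ¬ (W.b (t + 1) = 0 ∧ W.j (t + 1) ≠ W.j t ∧ (W.st (t + 1)).r (W.j (t + 1)) = 0)) →
    False

/-- **THE SUPERCRITICAL HOLE-FREE WINDOW IS EMPTY AT EVERY SHADE (PROVED).** [new] [folklore] -/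
theorem noSupercriticalHoleFreeJointTails_holds : NoSupercriticalHoleFreeJointTailsDeep := by
  intro p hp e he K _ _ _ _ s₀ hs W _ N hN hex hrec htr s hsN hq hM
  obtain ⟨M, hM⟩ := hM
  obtain ⟨u, hu, -, hf⟩ := TailShade.exists_holeFill hs hq ⟨hN, hsN, hex⟩ hrec htr M
  exact hM u hu hf

/-- Necessity of piece A (by letter: a subcritical shade is `≥ 4`, or it is `3` and then `p^e ≤ 6 < 7`). [folklore] -/
theorem sub_of_four (h : NoJointTailsFromFourDeep) : NoSubcriticalJointTailsDeep := by
  intro p hp e he K _ _ _ _ s₀ hs W hW N hN hex hrec htr s hsN h3 hsub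
  by_cases h4 : 4 ≤ s
  · exact h p hp e he K s₀ hs W hW N hN hex hrec htr (Or.inl (by rw [hsN]; exact_mod_cast h4))
  · exact h p hp e he K s₀ hs W hW N hN hex hrec htr (Or.inr (by omega))

/-- Necessity of piece B (by letter). [folklore] -/
theorem hole_of_four (h : NoJointTailsFromFourDeep) : NoHoleFillingTailsDeep := by
  intro p hp e he K _ _ _ _ s₀ hs W hW N hN hex hrec htr s hsN h4 _ _
  exact h p hp e he K s₀ hs W hW N hN hex hrec htr (Or.inl (by rw [hsN]; exact_mod_cast h4))

/-- **SUFFICIENCY (PROVED)** — the content of the node: a joint tail of shade `≥ 4` (or of the modulus `q = 4`) is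
subcritical, or it is supercritical of shade `≥ 4` and then (§P₊ REDUCTION + DEFICIT WINDOW, LAW J⁺) it fills holes
inside the deficit window infinitely often; the slices `s ≤ 2` are the tree's `FloorCut.noHighPlateaux_shade_one`
and g16's shade-two theorem. [new] [folklore] -/
theorem four_of_hole (hA : NoSubcriticalJointTailsDeep) (hB : NoHoleFillingTailsDeep) : NoJointTailsFromFourDeep := by
  intro p hp e he K _ _ _ _ s₀ hs W hW N hN hex hrec htr h4
  classical
  obtain ⟨o, ho, -⟩ := walk_nat hs W N
  obtain ⟨s, hsN, -⟩ := order_eq_shade_add_degree hs W N ho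
  have h1 := hW N
  rw [hsN] at h1
  have hs1 : 1 ≤ s := by exact_mod_cast h1
  rcases (show s = 1 ∨ s = 2 ∨ 3 ≤ s by omega) with h' | h' | h'
  · subst h'
    refine FloorCut.noHighPlateaux_shade_one hs W (N := N) (fun t ht => ⟨shade_of_plateau W hN hsN t ht, ?_⟩) htr
    obtain ⟨o', ho', hqo'⟩ := walk_nat hs W t
    have hne := hex t ht
    rw [ho'] at hne ⊢
    have hne' : o' ≠ p ^ e := by
      intro h''
      apply hne
      rw [h'']
    exact_mod_cast lt_of_le_of_ne hqo' (Ne.symm hne')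
  · subst h'
    exact noShadeTwoJointTails_holds p hp e he K s₀ hs W hW N hN hex hrec htr hsN
  · by_cases hsub : p ^ e + 3 ≤ 3 * s
    · exact hA p hp e he K s₀ hs W hW N hN hex hrec htr s hsN h' hsub
    · have hsup : 3 * s ≤ p ^ e + 2 := by omega
      have hs4 : 4 ≤ s := by
        rcases h4 with h4 | h4
        · rw [hsN] at h4
          exact_mod_cast h4
        · omega
      refine hB p hp e he K s₀ hs W hW N hN hex hrec htr s hsN hs4 hsup (fun M => ?_)
      obtain ⟨u, hu, hNu, hf⟩ := TailShade.exists_holeFill hs hsup ⟨hN, hsN, hex⟩ hrec htr M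
      obtain ⟨hw1, hw2⟩ := TailShade.holeFill_window hs ⟨hN, hsN, hex⟩ u hNu hf
      exact ⟨u, hu, hNu, hf.1, hf.2.1, hf.2.2, hw1, hw2⟩

/-- **THE ONE CERTIFIED EQUIVALENCE OF THIS NODE (PROVED, EXACT)**: g17's located residual IS «subcritical joint
tails ∧ supercritical hole-filling tails». [new] [folklore] -/
theorem four_iff_hole : NoJointTailsFromFourDeep ↔ NoSubcriticalJointTailsDeep ∧ NoHoleFillingTailsDeep :=
  ⟨fun h => ⟨sub_of_four h, hole_of_four h⟩, fun h => four_of_hole h.1 h.2⟩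

/-- EXACT, composed with g17: g16's located residual in the g18 letters. [new] [folklore] -/
theorem three_iff_hole : NoJointTailsFromThreeDeep ↔ NoSubcriticalJointTailsDeep ∧ NoHoleFillingTailsDeep :=
  three_iff_four.trans four_iff_hole

/-- **EXACT, composed with g16/g17**: the tree's joint residual IS «subcritical ∧ hole-filling». [new] [folklore] -/
theorem joint_iff_hole :
    ExitLaw.NoRepeatTranslationRecurrentExcessPlateauxDeep ↔ NoSubcriticalJointTailsDeep ∧ NoHoleFillingTailsDeep :=
  joint_iff_four.trans four_iff_hole

/-- **KERNEL BY NAME (aside 31770)**: deep arc law ∧ subcritical ∧ hole-filling ⇒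
`MaxContactCut.DefectWalksDeep`. [new] [folklore] -/
theorem defectWalksDeep_of_hole (hA : NoFreePointTailsDeep) (hS : NoSubcriticalJointTailsDeep)
    (hH : NoHoleFillingTailsDeep) : MaxContactCut.DefectWalksDeep :=
  defectWalksDeep_of_four hA (four_of_hole hS hH)

/-- **THE EXACT CUT OF 31770 AFTER g18 (PROVED, hypothesis-free)**:
`MaxContactCut.DefectWalksDeep ↔ deep arc law ∧ subcritical joint tails ∧ supercritical hole-filling tails`.
[new] [folklore] -/
theorem defectWalksDeep_iff_hole :
    MaxContactCut.DefectWalksDeep ↔ NoFreePointTailsDeep ∧ NoSubcriticalJointTailsDeep ∧ NoHoleFillingTailsDeep := by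
  rw [defectWalksDeep_iff_four, four_iff_hole]

/-- Necessity of piece A for 31770. [folklore] -/
theorem sub_of_defectWalksDeep (h : MaxContactCut.DefectWalksDeep) : NoSubcriticalJointTailsDeep :=
  (defectWalksDeep_iff_hole.mp h).2.1

/-- Necessity of piece B for 31770. [folklore] -/
theorem hole_of_defectWalksDeep (h : MaxContactCut.DefectWalksDeep) : NoHoleFillingTailsDeep :=
  (defectWalksDeep_iff_hole.mp h).2.2

/-- The decided window is WEAKER than the joint residual by letter. [folklore] -/
theorem supercriticalHoleFree_of_joint (h : ExitLaw.NoRepeatTranslationRecurrentExcessPlateauxDeep) :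
    NoSupercriticalHoleFreeJointTailsDeep :=
  fun p hp e he K _ _ _ _ s₀ hs W hW N hN hex hrec htr _ _ _ _ => h p hp e he K s₀ hs W hW N hN hex hrec htr

end BookingHole

end Summit.ResolutionOfSingularities.ResolutionOfSingularities.Theorems.HoleCut
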